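import Literature.AlgebraicGeometry.HodgeTheory.VHSDataHodgeClassesAlongPathsFlatSections
import Literature.AlgebraicGeometry.HodgeTheory.VHSDataHodgeClassesAlongPathsTensorConstructions
import HarnessLib

/-!
# Morphisms of VHS data from one fibre: a lattice map at `s` extends to a morphism iff it commutes with the monodromy and its class in `Hom(D₁, D₂)_s`
# remains of type `(0,0)` along every path — so at a HODGE-GENERIC point every monodromy-equivariant endomorphism of the Hodge structure `V_s`
# extends uniquely to an endomorphism of the variation (rigidity and extension of endomorphisms)

Topic `Literature/AlgebraicGeometry/HodgeTheory` (namespace `Literature.AlgebraicGeometry.Motives.VHSData`), lane `lit-hodgefound` (seat `p08`, row g61-#11);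
sequel of `VHSDataHodgeClassesAlongPathsTensorConstructions` (`isHodgeAlong_homClass_iff`, `isHodgeAlong_univ_hom_of_mem_hodgeGenericLocus`),
`VHSDataHodgeClassesAlongPathsDescent` (`Hom.isHodgeAlong_homClass_app`), `VHSDataHodgeClassesAlongPathsFlatSections` (`LocalSystem.transport_loop_eq_id_of_simplyConnected`)
over the tree's morphisms of VHS data (`Motives/FamiliesVHSMorphism`: `Hom`, `Hom.app`, `Hom.ofFlatOfIsHodgeAt`, `Hom.app_comp_transport`, `Hom.ext_of_app_eq`)
and `Hom(D₁, D₂)` (`Motives/FamiliesVHSHom`: `homClass`, `isHodgeAt_homClass_iff`).  THEOREMS ONLY — no definition, no named fact, no instance (D-0026 net debt `0`).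

PRINTED SOURCES, VERBATIM.  P. Deligne, LNM 163 (1970), I.1, Cor. 1.4: on a connected, locally path connected and locally simply connected `X` with base point
`x₀`, the functor `F ↦ F_{x₀}` is an equivalence between local systems on `X` and representations of `π₁(X, x₀)` — so `Hom(V₁, V₂) = Hom_{π₁}(V₁,x₀, V₂,x₀)`.
C. Voisin, *Hodge Theory I*, §7.3.1: a morphism of variations of Hodge structure is a morphism of local systems respecting the Hodge filtrations at every
point.  M. Green, P. Griffiths, M. Kerr, *Mumford–Tate Groups and Domains* (2012), Ch. III (held text p0064): at a generic point «the space of Hodge tensors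
`Hg_{Φ(η)}` is invariant under analytic continuation along paths in `S`» (here for `T^{1,1} = End`).

CONTENT.
* §1 ANY PATH-CONNECTED BASE: **`exists_hom_app_eq_of_forall_comp_transport`** (a lattice map `f : V₁,ℤ,s → V₂,ℤ,s` commuting with the monodromy of the
  loops at `s` and whose class `[f] ∈ Hom(D₁, D₂)_s` remains of type `(0,0)` along every path is `φ_s` for a morphism `φ : D₁ → D₂` — its lattice maps are
  the conjugates `γ_* f γ⁻¹_*`, well defined by equivariance, Hodge by genericity), `Hom.forall_comp_transport_and_isHodgeAlong` (the converse),
  **`exists_hom_app_eq_iff`**, **`existsUnique_hom_app_eq_iff`** (uniqueness by rigidity `Hom.ext_of_app_eq`), the filtration form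
  `exists_hom_app_eq_iff_forall_map_F_le`.
* §2 SIMPLY CONNECTED BASE (no monodromy): **`exists_hom_app_eq_iff_isHodgeAlong_of_simplyConnected`** (`f` extends iff `[f]` is generic).
* §3 AT A HODGE-GENERIC POINT (`D₁ = D₂ = D`, `End = T^{1,1}`): **`exists_hom_app_eq_iff_of_mem_hodgeGenericLocus`** (a monodromy-equivariant `f ∈ End(V_ℤ,s)`
  extends to an endomorphism of `D` iff `[f]` is of type `(0,0)` AT `s`, i.e. iff `f_ℚ` respects the Hodge filtration of `V_s`:
  `exists_hom_app_eq_iff_forall_map_F_le_of_mem_hodgeGenericLocus`), `existsUnique_hom_app_eq_of_mem_hodgeGenericLocus`, and on a simply connected base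
  **`exists_hom_app_eq_iff_isHodgeAt_of_mem_hodgeGenericLocus_of_simplyConnected`** (EVERY endomorphism of the Hodge structure `V_s` preserving the lattice
  extends uniquely to the variation).

HONEST SCOPE.  Integral morphisms (`Hom` is defined on the lattices `V_ℤ`); for `D₁ ≠ D₂` the Hodge-generic simplification is not available here
(`Hom(D₁, D₂)` is not one of the `T^{a,b}D`); no holomorphy is involved (transport algebra on the hypothesis structure `VHSData`).

## References

* [Deligne1970] P. Deligne, *Équations différentielles à points singuliers réguliers*, LNM 163 (1970), I.1, Prop. 1.3 and Cor. 1.4.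
* [VoisinHodgeI2002] C. Voisin, *Hodge Theory and Complex Algebraic Geometry I*, CUP (2002), §7.3.1, Lemma 7.25.
* [Schmid1973] W. Schmid, *Variation of Hodge structure: the singularities of the period mapping*, Invent. Math. 22 (1973), §2.
* [GreenGriffithsKerr2012] M. Green, P. Griffiths, M. Kerr, *Mumford–Tate Groups and Domains*, Ann. of Math. Studies 183 (2012), Ch. III, (III.2).
* [CattaniDeligneKaplan1995] E. Cattani, P. Deligne, A. Kaplan, *On the locus of Hodge classes*, J. AMS 8 (1995), §1 (p. 483).
* [DeligneHodgeII1971] P. Deligne, *Théorie de Hodge II*, Publ. Math. IHÉS 40 (1971), 1.1.6 and 2.1.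
-/

noncomputable section

open _root_.Topology _root_.Filter Set

namespace Literature.AlgebraicGeometry

open Motives Motives.HodgeStructure HodgeTheory Topology

namespace Motives.VHSData

variable {S : Type} [TopologicalSpace S] {k : ℤ}

/-! ## §1 Any path-connected base: equivariant generic lattice maps are the values of morphisms -/

section Extension

variable (D₁ D₂ : VHSData S k) {s : S}

/-- **EXTENSION OF AN EQUIVARIANT GENERIC LATTICE MAP TO A MORPHISM** (path-connected base): a `ℤ`-linear `f : V₁,ℤ,s → V₂,ℤ,s` commuting with the
monodromy of every loop at `s`, whose class `[f] ∈ Hom(D₁, D₂)_s` remains of type `(0,0)` along every path, is `φ_s` for a morphism `φ : D₁ → D₂` — with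
lattice maps the conjugates `γ_* ∘ f ∘ γ⁻¹_*` (independent of `γ` by equivariance, morphisms of Hodge structures by genericity).
[cite: Deligne1970, I.1, Prop. 1.3 and Cor. 1.4] [cite: VoisinHodgeI2002, §7.3.1] [cite: CattaniDeligneKaplan1995, §1 (p. 483)] -/
theorem exists_hom_app_eq_of_forall_comp_transport [PathConnectedSpace S] (f : D₁.VZ.fiber s →ₗ[ℤ] D₂.VZ.fiber s)
    (hequiv : ∀ γ : Path.Homotopic.Quotient s s, f ∘ₗ D₁.VZ.transport γ = D₂.VZ.transport γ ∘ₗ f)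
    (hf : (D₁.hom D₂).IsHodgeAlong 0 (D₁.homClass D₂ s f) univ) : ∃ φ : Hom D₁ D₂, φ.app s = f := by
  -- the candidate lattice maps: conjugates of `f` along the chosen paths `s ⇝ t`
  set F : ∀ t : S, D₁.VZ.fiber t →ₗ[ℤ] D₂.VZ.fiber t := fun t =>
    D₂.VZ.transport (Path.Homotopic.Quotient.mk (PathConnectedSpace.somePath s t)) ∘ₗ f ∘ₗ
      D₁.VZ.transport (Path.Homotopic.Quotient.mk (PathConnectedSpace.somePath s t)).symm with hF
  -- flatness: equivariance under the loop `γ_t · δ · γ_{t'}⁻¹`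
  have hflat : ∀ {t t' : S} (δ : Path.Homotopic.Quotient t t') (u : D₁.VZ.fiber t), F t' (D₁.VZ.transport δ u) = D₂.VZ.transport δ (F t u) := by
    intro t t' δ u
    have hloop := congrArg (fun g => g (D₁.VZ.transport (Path.Homotopic.Quotient.mk (PathConnectedSpace.somePath s t)).symm u))
      (hequiv (((Path.Homotopic.Quotient.mk (PathConnectedSpace.somePath s t)).trans δ).trans
        (Path.Homotopic.Quotient.mk (PathConnectedSpace.somePath s t')).symm))
    simp only [LinearMap.comp_apply, LocalSystem.transport_trans, LocalSystem.transport_apply_transport_symm] at hloop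
    simp only [hF, LinearMap.comp_apply]
    rw [hloop, LocalSystem.transport_apply_transport_symm]
  -- Hodge everywhere: the class of the conjugate is the continuation of `[f]`
  have hH : ∀ t : S, (D₁.hom D₂).IsHodgeAt t 0 (D₁.homClass D₂ t (F t)) := fun t =>
    (D₁.isHodgeAlong_homClass_iff D₂ f).1 hf (PathConnectedSpace.somePath s t) fun _ => mem_univ _
  refine ⟨Hom.ofFlatOfIsHodgeAt F hflat hH, ?_⟩
  rw [Hom.ofFlatOfIsHodgeAt_app]
  refine LinearMap.ext fun u => ?_
  have h2 := congrArg (fun g => g (D₁.VZ.transport (Path.Homotopic.Quotient.mk (PathConnectedSpace.somePath s s)).symm u))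
    (hequiv (Path.Homotopic.Quotient.mk (PathConnectedSpace.somePath s s)))
  simp only [LinearMap.comp_apply, LocalSystem.transport_apply_transport_symm] at h2
  simp only [hF, LinearMap.comp_apply]
  exact h2.symm

variable {D₁ D₂}

/-- **The converse: the lattice map `φ_s` of a morphism commutes with the monodromy and its class is generic.** [cite: Deligne1970, I.1] [cite: VoisinHodgeI2002, §7.3.1] -/
theorem Hom.forall_comp_transport_and_isHodgeAlong (φ : Hom D₁ D₂) (s : S) :
    (∀ γ : Path.Homotopic.Quotient s s, φ.app s ∘ₗ D₁.VZ.transport γ = D₂.VZ.transport γ ∘ₗ φ.app s) ∧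
      (D₁.hom D₂).IsHodgeAlong 0 (D₁.homClass D₂ s (φ.app s)) univ :=
  ⟨fun γ => φ.app_comp_transport γ, φ.isHodgeAlong_homClass_app s univ⟩

variable (D₁ D₂)

/-- **`Hom(D₁, D₂) → {f : V₁,ℤ,s → V₂,ℤ,s}`, `φ ↦ φ_s`, HAS IMAGE THE MONODROMY-EQUIVARIANT MAPS WITH GENERIC CLASS** (path-connected base: Deligne's
`Hom(V₁, V₂) = Hom_{π₁}(V₁,s, V₂,s)` read with the Hodge condition along paths). [cite: Deligne1970, I.1, Prop. 1.3 and Cor. 1.4] [cite: VoisinHodgeI2002, §7.3.1] -/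
theorem exists_hom_app_eq_iff [PathConnectedSpace S] (f : D₁.VZ.fiber s →ₗ[ℤ] D₂.VZ.fiber s) :
    (∃ φ : Hom D₁ D₂, φ.app s = f) ↔
      (∀ γ : Path.Homotopic.Quotient s s, f ∘ₗ D₁.VZ.transport γ = D₂.VZ.transport γ ∘ₗ f) ∧ (D₁.hom D₂).IsHodgeAlong 0 (D₁.homClass D₂ s f) univ := by
  constructor
  · rintro ⟨φ, rfl⟩
    exact φ.forall_comp_transport_and_isHodgeAlong s
  · exact fun h => D₁.exists_hom_app_eq_of_forall_comp_transport D₂ f h.1 h.2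

/-- **… AND IS INJECTIVE (rigidity): the extension is unique.** [cite: Deligne1970, I.1, Cor. 1.4] [cite: Schmid1973, §2] -/
theorem existsUnique_hom_app_eq_iff [PathConnectedSpace S] (f : D₁.VZ.fiber s →ₗ[ℤ] D₂.VZ.fiber s) :
    (∃! φ : Hom D₁ D₂, φ.app s = f) ↔
      (∀ γ : Path.Homotopic.Quotient s s, f ∘ₗ D₁.VZ.transport γ = D₂.VZ.transport γ ∘ₗ f) ∧ (D₁.hom D₂).IsHodgeAlong 0 (D₁.homClass D₂ s f) univ := by
  rw [← exists_hom_app_eq_iff]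
  exact ⟨fun h => h.exists, fun ⟨φ, hφ⟩ => ⟨φ, hφ, fun ψ hψ => Hom.ext_of_app_eq ψ φ s (hψ.trans hφ.symm)⟩⟩

/-- Filtration form: `f` extends to a morphism iff it commutes with the monodromy and every continued conjugate `γ_* f_ℚ γ⁻¹_*` respects the Hodge
filtrations. [cite: Deligne1970, I.1, Cor. 1.4] [cite: VoisinHodgeI2002, §7.3.1 and Lemma 7.25] -/
theorem exists_hom_app_eq_iff_forall_map_F_le [PathConnectedSpace S] (f : D₁.VZ.fiber s →ₗ[ℤ] D₂.VZ.fiber s) :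
    (∃ φ : Hom D₁ D₂, φ.app s = f) ↔
      (∀ γ : Path.Homotopic.Quotient s s, f ∘ₗ D₁.VZ.transport γ = D₂.VZ.transport γ ∘ₗ f) ∧
        ∀ ⦃t : S⦄ (γ : Path s t) (p : ℤ), ((D₁.hodge t).F p).map ((D₂.V.transport (Path.Homotopic.Quotient.mk γ) ∘ₗ D₁.homRat D₂ s f ∘ₗ
          D₁.V.transport (Path.Homotopic.Quotient.mk γ).symm).baseChange ℂ) ≤ (D₂.hodge t).F p := by
  rw [exists_hom_app_eq_iff, isHodgeAlong_homClass_iff_forall_map_F_le]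
  exact and_congr_right fun _ => ⟨fun h t γ p => h γ (fun _ => mem_univ _) p, fun h t γ _ p => h γ p⟩

end Extension

/-! ## §2 Simply connected base -/

section SimplyConnected

variable (D₁ D₂ : VHSData S k) [SimplyConnectedSpace S] {s : S}

/-- **On a SIMPLY CONNECTED base `f` extends to a morphism iff its class `[f]` is generic** (there is no monodromy to commute with).
[cite: Deligne1970, I.1, Cor. 1.4] [cite: VoisinHodgeI2002, §7.3.1] -/
theorem exists_hom_app_eq_iff_isHodgeAlong_of_simplyConnected (f : D₁.VZ.fiber s →ₗ[ℤ] D₂.VZ.fiber s) :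
    (∃ φ : Hom D₁ D₂, φ.app s = f) ↔ (D₁.hom D₂).IsHodgeAlong 0 (D₁.homClass D₂ s f) univ := by
  rw [exists_hom_app_eq_iff]
  refine ⟨fun h => h.2, fun h => ⟨fun γ => ?_, h⟩⟩
  rw [D₁.VZ.transport_loop_eq_id_of_simplyConnected γ, D₂.VZ.transport_loop_eq_id_of_simplyConnected γ, LinearMap.comp_id, LinearMap.id_comp]

/-- Uniqueness included. [cite: Deligne1970, I.1, Cor. 1.4] -/
theorem existsUnique_hom_app_eq_iff_isHodgeAlong_of_simplyConnected (f : D₁.VZ.fiber s →ₗ[ℤ] D₂.VZ.fiber s) :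
    (∃! φ : Hom D₁ D₂, φ.app s = f) ↔ (D₁.hom D₂).IsHodgeAlong 0 (D₁.homClass D₂ s f) univ := by
  rw [← exists_hom_app_eq_iff_isHodgeAlong_of_simplyConnected]
  exact ⟨fun h => h.exists, fun ⟨φ, hφ⟩ => ⟨φ, hφ, fun ψ hψ => Hom.ext_of_app_eq ψ φ s (hψ.trans hφ.symm)⟩⟩

end SimplyConnected

/-! ## §3 At a Hodge-generic point: equivariant endomorphisms of the Hodge structure `V_s` extend -/

section Generic

variable (D : VHSData S k) {s : S}

/-- **EXTENSION OF ENDOMORPHISMS AT A HODGE-GENERIC POINT**: for `s` Hodge-generic, a monodromy-equivariant `f ∈ End(V_ℤ,s)` extends to an endomorphism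
of the variation `D` iff its class `[f] ∈ End(D)_s` is of type `(0,0)` AT `s` (genericity along paths is automatic at a Hodge-generic point, `End = T^{1,1}`).
[cite: GreenGriffithsKerr2012, Ch. III (III.2)] [cite: Deligne1970, I.1, Cor. 1.4] [cite: VoisinHodgeI2002, §7.3.1 and Lemma 7.25] -/
theorem exists_hom_app_eq_iff_of_mem_hodgeGenericLocus [PathConnectedSpace S] (hs : s ∈ D.hodgeGenericLocus) (f : D.VZ.fiber s →ₗ[ℤ] D.VZ.fiber s) :
    (∃ φ : Hom D D, φ.app s = f) ↔
      (∀ γ : Path.Homotopic.Quotient s s, f ∘ₗ D.VZ.transport γ = D.VZ.transport γ ∘ₗ f) ∧ (D.hom D).IsHodgeAt s 0 (D.homClass D s f) := by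
  rw [exists_hom_app_eq_iff]
  exact and_congr_right fun _ => ⟨fun h => h.isHodgeAt (mem_univ s), fun h => isHodgeAlong_univ_hom_of_mem_hodgeGenericLocus hs h⟩

/-- Filtration form: **at a Hodge-generic point a monodromy-equivariant lattice endomorphism whose rationalization respects the Hodge filtration of `V_s`
extends to an endomorphism of `D`.** [cite: GreenGriffithsKerr2012, Ch. III (III.2)] [cite: VoisinHodgeI2002, Lemma 7.25] [cite: Deligne1970, I.1, Cor. 1.4] -/
theorem exists_hom_app_eq_iff_forall_map_F_le_of_mem_hodgeGenericLocus [PathConnectedSpace S] (hs : s ∈ D.hodgeGenericLocus)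
    (f : D.VZ.fiber s →ₗ[ℤ] D.VZ.fiber s) :
    (∃ φ : Hom D D, φ.app s = f) ↔
      (∀ γ : Path.Homotopic.Quotient s s, f ∘ₗ D.VZ.transport γ = D.VZ.transport γ ∘ₗ f) ∧
        ∀ p : ℤ, ((D.hodge s).F p).map ((D.homRat D s f).baseChange ℂ) ≤ (D.hodge s).F p := by
  rw [D.exists_hom_app_eq_iff_of_mem_hodgeGenericLocus hs, isHodgeAt_homClass_iff]

/-- Uniqueness included: **at a Hodge-generic point the restriction `End(D) → {f ∈ End(V_ℤ,s) | f monodromy-equivariant, f_ℚ ∈ End_HS(V_s)}` is a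
bijection.** [cite: GreenGriffithsKerr2012, Ch. III (III.2)] [cite: Deligne1970, I.1, Cor. 1.4] [cite: Schmid1973, §2] -/
theorem existsUnique_hom_app_eq_of_mem_hodgeGenericLocus [PathConnectedSpace S] (hs : s ∈ D.hodgeGenericLocus) {f : D.VZ.fiber s →ₗ[ℤ] D.VZ.fiber s}
    (hequiv : ∀ γ : Path.Homotopic.Quotient s s, f ∘ₗ D.VZ.transport γ = D.VZ.transport γ ∘ₗ f) (hf : (D.hom D).IsHodgeAt s 0 (D.homClass D s f)) :
    ∃! φ : Hom D D, φ.app s = f := by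
  obtain ⟨φ, hφ⟩ := (D.exists_hom_app_eq_iff_of_mem_hodgeGenericLocus hs f).2 ⟨hequiv, hf⟩
  exact ⟨φ, hφ, fun ψ hψ => Hom.ext_of_app_eq ψ φ s (hψ.trans hφ.symm)⟩

/-- **SIMPLY CONNECTED BASE, HODGE-GENERIC POINT: EVERY lattice endomorphism of `V_ℤ,s` whose class is of type `(0,0)` — i.e. every endomorphism of the
Hodge structure `V_s` preserving `V_ℤ,s` — extends (uniquely) to an endomorphism of the variation.** [cite: GreenGriffithsKerr2012, Ch. III (III.2)]
[cite: Deligne1970, I.1, Cor. 1.4] [cite: VoisinHodgeI2002, Lemma 7.25] -/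
theorem exists_hom_app_eq_iff_isHodgeAt_of_mem_hodgeGenericLocus_of_simplyConnected [SimplyConnectedSpace S] (hs : s ∈ D.hodgeGenericLocus)
    (f : D.VZ.fiber s →ₗ[ℤ] D.VZ.fiber s) : (∃ φ : Hom D D, φ.app s = f) ↔ (D.hom D).IsHodgeAt s 0 (D.homClass D s f) := by
  rw [exists_hom_app_eq_iff_isHodgeAlong_of_simplyConnected]
  exact ⟨fun h => h.isHodgeAt (mem_univ s), fun h => isHodgeAlong_univ_hom_of_mem_hodgeGenericLocus hs h⟩

/-- The same with the Hodge filtration of `V_s`. [cite: GreenGriffithsKerr2012, Ch. III (III.2)] [cite: VoisinHodgeI2002, Lemma 7.25] -/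
theorem exists_hom_app_eq_iff_forall_map_F_le_of_mem_hodgeGenericLocus_of_simplyConnected [SimplyConnectedSpace S] (hs : s ∈ D.hodgeGenericLocus)
    (f : D.VZ.fiber s →ₗ[ℤ] D.VZ.fiber s) :
    (∃ φ : Hom D D, φ.app s = f) ↔ ∀ p : ℤ, ((D.hodge s).F p).map ((D.homRat D s f).baseChange ℂ) ≤ (D.hodge s).F p := by
  rw [D.exists_hom_app_eq_iff_isHodgeAt_of_mem_hodgeGenericLocus_of_simplyConnected hs, isHodgeAt_homClass_iff]

end Generic

end Motives.VHSData

end Literature.AlgebraicGeometry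

end
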